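import Mathlib
import HarnessLib
import Summits.Ventures.LatticeQCDFlow.Exactness.SU2WilsonFlowLOExponential
import Literature.MathematicalPhysics.QuantumFieldTheory.Balaban1983to89.B10Eq18SigmaSU2Haar
import Literature.Geometry.Riemannian.RoundSphereReifenberg

/-!
# The closed-form unit quaternion of the engine's `SU(2)` drift and Wilson-flow sub-step IS the matrix exponential

HONEST FRAMING: exact (Metropolis-corrected) sampling algorithms for lattice gauge theory;
figures of merit are autocorrelation/cost numbers at stated couplings and volumes; no
continuum-physics claim.

Venture `LatticeQCDFlow` (cell pub-lqcd), topic `Exactness`; FANOUT row 14 (`eng-flowhmc`, engine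
`latflow.fthmc`, family B).  NEW WORK of the cell; no number.  `SU2WilsonFlowLOMember.lean` types
the engine's momentum drift `U ← exp(c P) U` and `SU2WilsonFlowLOExponential.lean` the masked
Wilson-flow sub-step `U' = U · 𝓔(c, Im(U⁻¹ ⋆ J))` through the CLOSED-FORM unit quaternion
`𝓔(c, y) = gaussUnit (cos (c r), c sinc (c r) y₁, c sinc (c r) y₂, c sinc (c r) y₃)`, `r = |y|`, and list
as NOT CLAIMED "the identification of the closed form with `NormedSpace.exp` of the `su(2)` matrix".
This file discharges it, BY NAME from the tree: the literature formalisation of Bałaban's `SU(2)`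
chart (`Balaban1983to89.B10Eq18SigmaSU2Haar.exp_su2Coord`, Euler's formula
`exp(iΣ A^aσ_a) = cos|A|·1 + sinc|A|·iΣ A^aσ_a` in `M₂(ℂ)`, itself Mathlib's
`Quaternion.exp_of_re_eq_zero` read through the quaternion ↔ Pauli dictionary) applies verbatim
once row 9's quaternion coordinates `quatVec` (`HaarSU2Gaussian.lean`) are matched with the Pauli
coordinates `su2Coord` (`B10Eq18SigmaSU2.lean`):

* `quatVec_im_eq_su2Coord` — `quatVec (0, y₁, y₂, y₃) = su2Coord (y₁, y₂, y₃) = i(y₁σ₁ + y₂σ₂ + y₃σ₃)`,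
  an element of `su(2)` (`quatVec_im_mem_su`);
* **`coe_gaussUnit_closedForm_eq_exp`** — for all real `c, y₁, y₂, y₃`,
  `gaussUnit (cos (c r), c sinc (c r) y₁, c sinc (c r) y₂, c sinc (c r) y₃) = exp (quatVec (0, c y₁, c y₂, c y₃))`
  as `2 × 2` complex matrices (`r = √(y₁² + y₂² + y₃²)`; `exp` = `NormedSpace.exp`, the matrix
  exponential): the closed form the engine evaluates IS the exponential map `su(2) → SU(2)`;
* `exp_quatVec_im_mem` — `exp (quatVec (0, y)) ∈ SU(2)`;
* **`coe_su2Drift_eq_exp`** — the typed momentum drift factor at a link is LITERALLY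
  `exp (c P_ℓ)`, `P_ℓ = quatVec (0, p_ℓ) ∈ su(2)` (the engine's `V ← expm(c P) V`);
* **`coe_su2Substep_eq_mul_exp`** — the typed Wilson-flow / residual sub-step is LITERALLY the
  Lie–Euler step `U' = U · exp (c · Im (U⁻¹ ⋆ J))` with the matrix exponential;
* **`coe_su2Substep_eq_exp_mul`** — equivalently, in the engine's letters, `U' = exp(−c·P(U R))·U`
  with `R = (quatVec J)ᴴ` the (weighted) staple sum and `P(W) = ½(W − Wᴴ)` (traceless here,
  `trace_sub_conjTranspose_quat`): the code's `expm(-eps * TA(U @ R)) @ U`.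

NOT CLAIMED: the normalisation of `c` against Lüscher's flow time; `SU(N ≥ 3)`; any number.
Nothing of the cited literature files is re-proved (they are imported by name).
-/

noncomputable section

namespace Summit.Ventures.LatticeQCDFlow.Exactness

open Real InnerProductGeometry WithLp NormedSpace
open Literature.MathematicalPhysics.QuantumFieldTheory
open Literature.MathematicalPhysics.QuantumFieldTheory.Balaban1983to89.B10Eq18SigmaSU2 (su2Coord su2Coord_mem_su)
open Literature.MathematicalPhysics.QuantumFieldTheory.Balaban1983to89.B10Eq18SigmaSU2Haar (exp_su2Coord exp_su2Coord_mem)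
open scoped Matrix

/-! ## The dictionary: imaginary quaternion coordinates are Pauli coordinates -/

/-- **`quatVec (0, y₁, y₂, y₃) = i(y₁σ₁ + y₂σ₂ + y₃σ₃)`**: row 9's quaternion matrix of a purely
imaginary coordinate vector is the Pauli-coordinate `su(2)` element `su2Coord (y₁, y₂, y₃)` of the
literature file (entrywise). -/
theorem quatVec_im_eq_su2Coord (y₁ y₂ y₃ : ℝ) :
    quatVec (toLp 2 ![0, y₁, y₂, y₃]) = su2Coord (toLp 2 ![y₁, y₂, y₃] : EuclideanSpace ℝ (Fin 3)) := by
  ext i j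
  fin_cases i <;> fin_cases j <;> apply Complex.ext <;> simp [quatVec, quatOf, su2Coord]

/-- Hence `quatVec (0, y₁, y₂, y₃)` lies in the Lie algebra `su(2)` (traceless anti-Hermitian). -/
theorem quatVec_im_mem_su (y₁ y₂ y₃ : ℝ) :
    quatVec (toLp 2 ![0, y₁, y₂, y₃]) ∈ Literature.Algebra.Lie.CompactKillingForm.su (Fin 2) := by
  rw [quatVec_im_eq_su2Coord]
  exact su2Coord_mem_su _

/-- The Euclidean length of the Pauli coordinate vector: `‖(y₁, y₂, y₃)‖ = √(y₁² + y₂² + y₃²)`. -/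
theorem norm_toLp_three (y₁ y₂ y₃ : ℝ) :
    ‖(toLp 2 ![y₁, y₂, y₃] : EuclideanSpace ℝ (Fin 3))‖ = √(y₁ ^ 2 + y₂ ^ 2 + y₃ ^ 2) := by
  rw [EuclideanSpace.norm_eq, Fin.sum_univ_three]
  congr 1
  simp [sq_abs]

/-! ## The closed form is the exponential -/

/-- **The engine's closed-form unit quaternion IS the matrix exponential.**  For all real
`c, y₁, y₂, y₃`, with `r = √(y₁² + y₂² + y₃²)`:
`gaussUnit (cos (c r), c sinc (c r) y₁, c sinc (c r) y₂, c sinc (c r) y₃) = exp (quatVec (0, c y₁, c y₂, c y₃))`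
as `2 × 2` complex matrices — Euler's formula in `SU(2)` (`B10Eq18SigmaSU2Haar.exp_su2Coord`)
through the dictionary `quatVec_im_eq_su2Coord`; the coordinate vector on the left has unit length,
so `gaussUnit` does not renormalise it. -/
theorem coe_gaussUnit_closedForm_eq_exp (c y₁ y₂ y₃ : ℝ) :
    ((gaussUnit (toLp 2 ![Real.cos (c * √(y₁ ^ 2 + y₂ ^ 2 + y₃ ^ 2)),
        c * sinc (c * √(y₁ ^ 2 + y₂ ^ 2 + y₃ ^ 2)) * y₁,
        c * sinc (c * √(y₁ ^ 2 + y₂ ^ 2 + y₃ ^ 2)) * y₂,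
        c * sinc (c * √(y₁ ^ 2 + y₂ ^ 2 + y₃ ^ 2)) * y₃]) : Matrix.specialUnitaryGroup (Fin 2) ℂ) :
        Matrix (Fin 2) (Fin 2) ℂ) =
      exp (quatVec (toLp 2 ![0, c * y₁, c * y₂, c * y₃])) := by
  set r : ℝ := √(y₁ ^ 2 + y₂ ^ 2 + y₃ ^ 2) with hr
  have hr0 : 0 ≤ r := Real.sqrt_nonneg _
  have hr2 : y₁ ^ 2 + y₂ ^ 2 + y₃ ^ 2 = r ^ 2 := (Real.sq_sqrt (by positivity)).symm
  -- the right-hand side by Euler's formula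
  have hA : ‖(toLp 2 ![c * y₁, c * y₂, c * y₃] : EuclideanSpace ℝ (Fin 3))‖ = |c| * r := by
    rw [norm_toLp_three, show (c * y₁) ^ 2 + (c * y₂) ^ 2 + (c * y₃) ^ 2 = (|c| * r) ^ 2 by
      rw [mul_pow |c| r 2, sq_abs, ← hr2]; ring]
    exact Real.sqrt_sq (mul_nonneg (abs_nonneg c) hr0)
  have hcos : Real.cos (|c| * r) = Real.cos (c * r) := by
    rcases le_total 0 c with hc | hc
    · rw [abs_of_nonneg hc]
    · rw [abs_of_nonpos hc, neg_mul, Real.cos_neg]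
  have hsinc : sinc (|c| * r) = sinc (c * r) := by
    rcases le_total 0 c with hc | hc
    · rw [abs_of_nonneg hc]
    · rw [abs_of_nonpos hc, neg_mul, sinc_neg]
  rw [quatVec_im_eq_su2Coord, exp_su2Coord, hA, hcos, hsinc, ← quatVec_im_eq_su2Coord]
  -- the left-hand side: a unit vector, so `gaussUnit` is `quatVec`
  set v : R4 := toLp 2 ![Real.cos (c * r), c * sinc (c * r) * y₁, c * sinc (c * r) * y₂,
    c * sinc (c * r) * y₃] with hv
  have hms : c * r * sinc (c * r) = Real.sin (c * r) := Literature.Geometry.Riemannian.mul_sinc _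
  have hv2 : ‖v‖ ^ 2 = 1 := by
    rw [EuclideanSpace.real_norm_sq_eq, Fin.sum_univ_four]
    simp only [hv, PiLp.toLp_apply, Matrix.cons_val_zero, Matrix.cons_val_one, Matrix.cons_val]
    linear_combination Real.cos_sq_add_sin_sq (c * r) +
      (c * r * sinc (c * r) + Real.sin (c * r)) * hms + (c * sinc (c * r)) ^ 2 * hr2
  have hv1 : ‖v‖ = 1 := by
    have h := (pow_left_inj₀ (norm_nonneg v) zero_le_one two_ne_zero).1 (by rw [hv2, one_pow])
    exact h
  have hv0 : v ≠ 0 := fun h => by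
    rw [h, norm_zero] at hv1
    exact zero_ne_one hv1
  rw [coe_gaussUnit_of_ne_zero hv0, hv1, inv_one, one_smul, hv]
  generalize Real.cos (c * r) = a
  generalize sinc (c * r) = s
  ext i j
  fin_cases i <;> fin_cases j <;> apply Complex.ext <;>
    simp [quatVec, quatOf, Matrix.smul_apply] <;> ring

/-- **`exp` of a purely imaginary quaternion coordinate matrix is special unitary**:
`exp (quatVec (0, y₁, y₂, y₃)) ∈ SU(2)`. -/
theorem exp_quatVec_im_mem (y₁ y₂ y₃ : ℝ) :
    exp (quatVec (toLp 2 ![0, y₁, y₂, y₃])) ∈ Matrix.specialUnitaryGroup (Fin 2) ℂ := by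
  rw [quatVec_im_eq_su2Coord]
  exact exp_su2Coord_mem _

/-! ## The engine's drift and sub-step, literally as exponentials -/

section Engine

variable {d L : ℕ}

/-- **The typed momentum drift IS `exp(c P)`.**  For momenta `p : (Edge × Fin 3) → ℝ` and a link
`ℓ`, the drift factor of `SU2WilsonFlowLOMember.lean` (by which the link is left-multiplied) is the
matrix exponential of the `su(2)` element `c · quatVec (0, p_ℓ)` — the engine's `V ← expm(c P) V`. -/
theorem coe_su2Drift_eq_exp (c : ℝ) (p : (Edge d L × Fin 3) → ℝ) (ℓ : Edge d L) :
    ((gaussUnit (toLp 2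
        ![Real.cos (c * Real.sqrt (p (ℓ, 0) ^ 2 + p (ℓ, 1) ^ 2 + p (ℓ, 2) ^ 2)),
          c * Real.sinc (c * Real.sqrt (p (ℓ, 0) ^ 2 + p (ℓ, 1) ^ 2 + p (ℓ, 2) ^ 2)) * p (ℓ, 0),
          c * Real.sinc (c * Real.sqrt (p (ℓ, 0) ^ 2 + p (ℓ, 1) ^ 2 + p (ℓ, 2) ^ 2)) * p (ℓ, 1),
          c * Real.sinc (c * Real.sqrt (p (ℓ, 0) ^ 2 + p (ℓ, 1) ^ 2 + p (ℓ, 2) ^ 2)) * p (ℓ, 2)]) :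
        Matrix.specialUnitaryGroup (Fin 2) ℂ) : Matrix (Fin 2) (Fin 2) ℂ) =
      exp (quatVec (toLp 2 ![0, c * p (ℓ, 0), c * p (ℓ, 1), c * p (ℓ, 2)])) :=
  coe_gaussUnit_closedForm_eq_exp c (p (ℓ, 0)) (p (ℓ, 1)) (p (ℓ, 2))

/-- **The typed `SU(2)` sub-step IS the Lie–Euler step with the matrix exponential**:
`gaussUnit (geodesicKick c J (vecQuat U)) = U · exp (quatVec (0, c j₁, c j₂, c j₃))`, `j = U⁻¹ ⋆ J`
(`= lmulIso U⁻¹ J`), as matrices — `SU2WilsonFlowLOExponential.gaussUnit_geodesicKick_vecQuat`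
composed with `coe_gaussUnit_closedForm_eq_exp`.  Applies to the LO Wilson-flow sub-step
(`J` = conjugate staple sum) and to the learned residual layers (`J` = weighted conjugate staple
sum) alike. -/
theorem coe_su2Substep_eq_mul_exp (U : Matrix.specialUnitaryGroup (Fin 2) ℂ) (c : ℝ) (J : R4) :
    ((gaussUnit (geodesicKick c J (vecQuat (U : Matrix (Fin 2) (Fin 2) ℂ))) :
        Matrix.specialUnitaryGroup (Fin 2) ℂ) : Matrix (Fin 2) (Fin 2) ℂ) =
      (U : Matrix (Fin 2) (Fin 2) ℂ) *
        exp (quatVec (toLp 2 ![0, c * (lmulIso U⁻¹ J) 1, c * (lmulIso U⁻¹ J) 2, c * (lmulIso U⁻¹ J) 3])) := by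
  rw [gaussUnit_geodesicKick_vecQuat, WilsonFlow.coe_mul_SU, coe_gaussUnit_closedForm_eq_exp]

/-- Imaginary part as a matrix: `quatVec (0, x₁, x₂, x₃) = ½ (quatVec x − (quatVec x)ᴴ)` — for a
quaternion matrix the anti-Hermitian part is already traceless, so this is also the traceless
anti-Hermitian projection `P` the engine applies. -/
theorem quatVec_im_eq_half_sub_conjTranspose (x : R4) :
    quatVec (toLp 2 ![0, x 1, x 2, x 3]) = (1 / 2 : ℂ) • (quatVec x - (quatVec x)ᴴ) := by
  ext i j
  fin_cases i <;> fin_cases j <;> apply Complex.ext <;>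
    simp [quatVec, quatOf, Matrix.conjTranspose_apply, Matrix.sub_apply, Matrix.smul_apply] <;> ring

/-- The anti-Hermitian part of `W = quatVec J · Uᴴ` is traceless (so the engine's traceless
projection `P(W) = ½(W − Wᴴ) − tr(W − Wᴴ)/(2N)` reduces to `½(W − Wᴴ)` on the `SU(2)` rung). -/
theorem trace_sub_conjTranspose_quat (U : Matrix.specialUnitaryGroup (Fin 2) ℂ) (J : R4) :
    Matrix.trace (quatVec J * (U : Matrix (Fin 2) (Fin 2) ℂ)ᴴ - (quatVec J * (U : Matrix (Fin 2) (Fin 2) ℂ)ᴴ)ᴴ) = 0 := by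
  have hq : IsQuat (quatVec J * (U : Matrix (Fin 2) (Fin 2) ℂ)ᴴ) := by
    rw [← WilsonFlow.coe_inv_SU]
    exact (isQuat_quatVec J).mul (IsQuat.of_mem_specialUnitaryGroup (U⁻¹).2)
  have h11 := hq.diag
  simp only [Matrix.trace, Matrix.diag_apply, Fin.sum_univ_two, Matrix.sub_apply,
    Matrix.conjTranspose_apply, h11, RCLike.star_def, Complex.conj_conj]
  ring

/-- **The typed `SU(2)` sub-step in the engine's letters: `U' = exp(−c·P(U R)) · U`.**  With
`R = (quatVec J)ᴴ` (for the LO member: the staple sum; for a residual layer: the weighted staple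
sum) and `W = U R`, the kick `gaussUnit (geodesicKick c J (vecQuat U))` equals
`exp (−(c/2) · (W − Wᴴ)) · U` — here written with `Wᴴ = quatVec J · Uᴴ`, i.e.
`exp ((c/2) · (quatVec J · Uᴴ − (quatVec J · Uᴴ)ᴴ)) · U` — which is LITERALLY the engine's
`expm(-c * TA(U @ R)) @ U` (`maps.wflow_substep_flat` / `resid_substep_flat`; the trace part of `TA`
vanishes by `trace_sub_conjTranspose_quat`).  Proof: the right-translation form
`U · exp(c · Im(U⁻¹ ⋆ J))` conjugated through `U` (`Matrix.exp_conj`). -/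
theorem coe_su2Substep_eq_exp_mul (U : Matrix.specialUnitaryGroup (Fin 2) ℂ) (c : ℝ) (J : R4) :
    ((gaussUnit (geodesicKick c J (vecQuat (U : Matrix (Fin 2) (Fin 2) ℂ))) :
        Matrix.specialUnitaryGroup (Fin 2) ℂ) : Matrix (Fin 2) (Fin 2) ℂ) =
      exp ((((c / 2 : ℝ)) : ℂ) • (quatVec J * (U : Matrix (Fin 2) (Fin 2) ℂ)ᴴ -
          (quatVec J * (U : Matrix (Fin 2) (Fin 2) ℂ)ᴴ)ᴴ)) * (U : Matrix (Fin 2) (Fin 2) ℂ) := by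
  have hX : quatVec (toLp 2 ![0, c * (lmulIso U⁻¹ J) 1, c * (lmulIso U⁻¹ J) 2, c * (lmulIso U⁻¹ J) 3]) =
      (((c / 2 : ℝ)) : ℂ) • ((U : Matrix (Fin 2) (Fin 2) ℂ)ᴴ * quatVec J -
        ((U : Matrix (Fin 2) (Fin 2) ℂ)ᴴ * quatVec J)ᴴ) := by
    have h1 : (toLp 2 ![0, c * (lmulIso U⁻¹ J) 1, c * (lmulIso U⁻¹ J) 2, c * (lmulIso U⁻¹ J) 3] : R4) =
        c • toLp 2 ![0, (lmulIso U⁻¹ J) 1, (lmulIso U⁻¹ J) 2, (lmulIso U⁻¹ J) 3] := by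
      ext i
      fin_cases i <;> simp
    have h2 : quatVec (lmulIso U⁻¹ J) = (U : Matrix (Fin 2) (Fin 2) ℂ)ᴴ * quatVec J := by
      rw [quatVec_lmulIso, WilsonFlow.coe_inv_SU]
    rw [h1, quatVec_smul, quatVec_im_eq_half_sub_conjTranspose, h2, smul_smul]
    congr 1
    push_cast
    ring
  rw [coe_su2Substep_eq_mul_exp, hX]
  set Um : Matrix (Fin 2) (Fin 2) ℂ := (U : Matrix (Fin 2) (Fin 2) ℂ) with hUm
  have hUU : Um * Umᴴ = 1 := by
    rw [hUm, ← WilsonFlow.coe_inv_SU, ← WilsonFlow.coe_mul_SU, mul_inv_cancel, OneMemClass.coe_one]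
  have hUU' : Umᴴ * Um = 1 := by
    rw [hUm, ← WilsonFlow.coe_inv_SU, ← WilsonFlow.coe_mul_SU, inv_mul_cancel, OneMemClass.coe_one]
  have hinv : Um⁻¹ = Umᴴ := Matrix.inv_eq_right_inv hUU
  have hunit : IsUnit Um := (Matrix.isUnit_iff_isUnit_det _).mpr (by
    rw [hUm, (Matrix.mem_specialUnitaryGroup_iff.mp U.2).2]
    exact isUnit_one)
  have e1 : Um * (Umᴴ * quatVec J) * Umᴴ = quatVec J * Umᴴ := by
    rw [← Matrix.mul_assoc, hUU, Matrix.one_mul]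
  have e2 : Um * (Umᴴ * quatVec J)ᴴ * Umᴴ = (quatVec J * Umᴴ)ᴴ := by
    rw [Matrix.conjTranspose_mul, Matrix.conjTranspose_mul, Matrix.conjTranspose_conjTranspose,
      Matrix.mul_assoc, Matrix.mul_assoc, hUU, Matrix.mul_one]
  have key : Um * exp ((((c / 2 : ℝ)) : ℂ) • (Umᴴ * quatVec J - (Umᴴ * quatVec J)ᴴ)) * Um⁻¹ =
      exp ((((c / 2 : ℝ)) : ℂ) • (quatVec J * Umᴴ - (quatVec J * Umᴴ)ᴴ)) := by
    rw [← Matrix.exp_conj _ _ hunit, Matrix.mul_smul, Matrix.smul_mul, Matrix.mul_sub,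
      Matrix.sub_mul, hinv, e1, e2]
  calc Um * exp ((((c / 2 : ℝ)) : ℂ) • (Umᴴ * quatVec J - (Umᴴ * quatVec J)ᴴ))
      = Um * exp ((((c / 2 : ℝ)) : ℂ) • (Umᴴ * quatVec J - (Umᴴ * quatVec J)ᴴ)) * Um⁻¹ * Um := by
        rw [Matrix.mul_assoc _ Um⁻¹ Um, hinv, hUU', Matrix.mul_one]
    _ = exp ((((c / 2 : ℝ)) : ℂ) • (quatVec J * Umᴴ - (quatVec J * Umᴴ)ᴴ)) * Um := by rw [key]

end Engine

end Summit.Ventures.LatticeQCDFlow.Exactness
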